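import Summits.BirchSwinnertonDyer.BirchSwinnertonDyer.Theorems.ManinLocalTwoThreeManinConstantFortyTwo
import Summits.BirchSwinnertonDyer.BirchSwinnertonDyer.Theorems.ManinLocalTwoThreeDyadicTwistFamiliesFactFree
import HarnessLib

/-!
# The root `42` for the fact-free twist families: `LevelManinOne 42`, its odd and dyadic twist images, and the crux shapes

Cell bsd-f2-manin, route `ManinLocalTwoThree` (cruxes C2 `ManinOddAtFour` stmt-22967 / C3 `ManinPrimeToThreeAtNine` stmt-22968),
prover seat p3 gen 25; the level-`42` twin of `…TwistRootsThirty`.  `LevelFortyTwo.abs_maninConstant_eq_one_fortyTwo` (this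
seat: pinning kernel + Bracket–Sturm certificate + Néron squeeze, FACT-FREE) is verbatim `LevelManinOne 42`; the tree's twist engines
(planner -desc, THEOREMS 68.A–C / 69.A–C) turn it into `|c| = 1` (hence `2 ∤ c`, `3 ∤ c`) on the ADDITIVE twist images of the semistable
class `42a`: `42a ⊗ χ₋₄` (`N = 336 = 2⁴·3·7`, C2), `42a ⊗ χ±8` (`1344`, C2), `42a ⊗ χ₋₃` (`126 = 2·3²·7`, C3), `42a ⊗ χ₋₇` (`294 = 2·3·7²`, the
residual C5 domain), … .  The Stevens `η`-clause of the dyadic engine is met because every curve carrying an `X₀(42)`-datum is multiplicative at `2`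
(supplied as a hypothesis; cf. `LevelFortyTwo.truth_fortyTwo`: `a₂(W) = 1`).

HONEST SCOPE.  The statements cover exactly the twist images of level `42` (hypotheses as in the engines).  Nothing here proves C2, C3
(∀ N), the rung, Manin's conjecture or BSD; items 22967/22968 stay OPEN.  No definition, no named fact, no sorry.
[cite: Stevens1989, Lemma (5.2), (5.4), (5.6)–(5.7)] [cite: Pal2012, Prop. 2.4] [cite: CremonaAlgorithms1997, Table 1 (42a1, 126b1, 336)]
-/

set_option autoImplicit false
-- lint-debt: the directory name repeats the summit name (sibling precedent `ManinLocalTwoThreeTwistRootsThirty.lean`)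
set_option linter.dupNamespace false

noncomputable section

open Complex
open scoped MatrixGroups ModularForm
open ModularForm CongruenceSubgroup
open Literature.NumberTheory.EllipticCurves Literature.NumberTheory.EllipticCurves.ModularForms
open Summit.BirchSwinnertonDyer.BirchSwinnertonDyer.Theorems.ManinLocalTwoThree

namespace Summit.BirchSwinnertonDyer.BirchSwinnertonDyer.Theorems.ManinLocalTwoThree.TwistRootsFortyTwo

open WeierstrassCurve TwistFamilies DyadicTwistFamilies

/-! ## §1 The root and its families -/

/-- **`LevelManinOne 42`** — level `42 = 2·3·7` (semistable, genus `5`, one class `42a`) is COMPLETE, fact-free (p3 g25: pinning kernel +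
Bracket–Sturm + Néron squeeze). [cite: CremonaAlgorithms1997, Table 1 (42a1)] -/
theorem levelManinOne_fortyTwo : LevelManinOne 42 :=
  fun W _ _ D h ↦ LevelFortyTwo.abs_maninConstant_eq_one_fortyTwo W D h

/-- **`TwistLevelManinOne 42 p` for every odd prime `p`** (THEOREM 68.A on the root `42`): `|c| = 1` on the `χ_p`-twist image of level `42`
— at `p = 3` the C3 level `126`, at `p = 7` the level `294`, else the levels `42p²`. [cite: Stevens1989, Lemma (5.2), (5.4)] -/
theorem twistLevelManinOne_fortyTwo {p : ℕ} [Fact p.Prime] (hp2 : p ≠ 2) : TwistLevelManinOne 42 p :=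
  twistLevelManinOne_of_levelManinOne levelManinOne_fortyTwo hp2

/-- **`DyadicTwistLevelManinOne 42 d`, `d ∈ {−1, 2, −2}`** (THEOREM 69.A on the root `42`): the C2 levels `336` (`42a ⊗ χ₋₄`) and `1344`
(`χ±8`). [cite: Stevens1989, Lemma (5.6)–(5.7)] [cite: Pal2012, Prop. 2.4] -/
theorem dyadicTwistLevelManinOne_fortyTwo {d : ℤ} (hd : d = -1 ∨ d = 2 ∨ d = -2) : DyadicTwistLevelManinOne 42 d :=
  dyadicTwistLevelManinOne_of_levelManinOne levelManinOne_fortyTwo hd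

/-- **Per-newform closure at the root `42`** (THEOREM 68.C): every `χ_p`-twist (`p` odd, the carrier good at `p`) of the newform of an
`X₀(42)`-datum has `NewformManinOne`. [cite: Stevens1989, Lemma (5.2), (5.4)] -/
theorem newformManinOne_twist_fortyTwo {p : ℕ} [Fact p.Prime] (hp2 : p ≠ 2)
    {χ : DirichletCharacter ℂ p} (hχ : χ.IsQuadratic) (hprim : χ.IsPrimitive)
    {W₀ : WeierstrassCurve ℚ} [W₀.IsElliptic] (D₀ : ModularParametrizationData W₀ 42)
    (hgood : W₀.HasGoodReductionAtPrime p)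
    {N : ℕ} [NeZero N] (hMN : 42 ∣ N) (hpN : p ^ 2 ∣ N) (g' : CuspForm (Gamma0 N) 2)
    (hg' : ∀ n : ℕ, cuspCoeff g' n = χ n * cuspCoeff D₀.f n) : NewformManinOne g' :=
  newformManinOne_twist_of_levelManinOne levelManinOne_fortyTwo hp2 hχ hprim D₀ hgood hMN hpN g' hg'

/-! ## §2 The crux shapes on named members -/

/-- **C2 on `42a ⊗ χ₋₄` (level `336 = 2⁴·3·7`)**: `|c(D')| = 1 ∧ 2 ∤ c(D') ∧ 3 ∤ c(D')` for every lattice-optimal `X₀(336)`-datum `D'` of a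
globally minimal `W'` additive at `2` and isogenous to the `−1`-twist of a `2`-semistable carrier of a lattice-optimal `X₀(42)`-datum.
No printed fact. [cite: CremonaAlgorithms1997, Table 1 (336)] -/
theorem shapes_on_family_fortyTwo_negOne
    (W : WeierstrassCurve ℚ) [W.IsElliptic] [W.IsGloballyMinimal] (D : ModularParametrizationData W 42)
    (hopt : ∀ z ∈ D.L.lattice, ∃ w ∈ periodLattice D.f, z = D.c * w)
    (hsemi : W.HasGoodReductionAtPrime 2 ∨ W.HasMultiplicativeReductionAtPrime 2)
    (W' : WeierstrassCurve ℚ) [W'.IsElliptic] [W'.IsGloballyMinimal] [NeZero (336 : ℕ)]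
    (D' : ModularParametrizationData W' 336)
    (htw : IsIsogenous W' (W.quadraticTwist ((-1 : ℤ) : ℚ)))
    (hadd' : ¬ W'.HasGoodReductionAtPrime 2 ∧ ¬ W'.HasMultiplicativeReductionAtPrime 2)
    (hopt' : ∀ z ∈ D'.L.lattice, ∃ w ∈ periodLattice D'.f, z = D'.c * w) :
    |D'.maninConstant| = 1 ∧ ¬ (2 : ℤ) ∣ D'.maninConstant ∧ ¬ (3 : ℤ) ∣ D'.maninConstant :=
  shapes_of_dyadicTwistLevelManinOne (dyadicTwistLevelManinOne_fortyTwo (Or.inl rfl)) W D hopt hsemi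
    (Or.inl rfl) W' 336 D' (by norm_num) (by norm_num) htw hadd' hopt'

/-- **C2 on `42a ⊗ χ±8` (level `1344 = 2⁶·3·7`)**, for a carrier MULTIPLICATIVE at `2` (Stevens' `η`-clause; automatic for conductor `42`,
cf. `LevelFortyTwo.truth_fortyTwo`). [cite: Stevens1989, Lemma (5.6)–(5.7)] -/
theorem shapes_on_family_fortyTwo_two {d : ℤ} (hd : d = 2 ∨ d = -2)
    (W : WeierstrassCurve ℚ) [W.IsElliptic] [W.IsGloballyMinimal] (D : ModularParametrizationData W 42)
    (hopt : ∀ z ∈ D.L.lattice, ∃ w ∈ periodLattice D.f, z = D.c * w)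
    (hmult : W.HasMultiplicativeReductionAtPrime 2)
    (W' : WeierstrassCurve ℚ) [W'.IsElliptic] [W'.IsGloballyMinimal] [NeZero (1344 : ℕ)]
    (D' : ModularParametrizationData W' 1344)
    (htw : IsIsogenous W' (W.quadraticTwist (d : ℚ)))
    (hadd' : ¬ W'.HasGoodReductionAtPrime 2 ∧ ¬ W'.HasMultiplicativeReductionAtPrime 2)
    (hopt' : ∀ z ∈ D'.L.lattice, ∃ w ∈ periodLattice D'.f, z = D'.c * w) :
    |D'.maninConstant| = 1 ∧ ¬ (2 : ℤ) ∣ D'.maninConstant ∧ ¬ (3 : ℤ) ∣ D'.maninConstant :=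
  have hd3 : d = -1 ∨ d = 2 ∨ d = -2 := Or.inr hd
  have habs : (4 * d.natAbs) ^ 2 = 64 := by rcases hd with rfl | rfl <;> rfl
  shapes_of_dyadicTwistLevelManinOne (dyadicTwistLevelManinOne_fortyTwo hd3) W D hopt (Or.inr hmult)
    (Or.inr (Or.inl hmult)) W' 1344 D' (by norm_num) (by rw [habs]; norm_num) htw hadd' hopt'

/-- **C3 on `42a ⊗ χ₋₃` (level `126 = 2·3²·7`, `9 ∥ N`)**: `|c(D')| = 1 ∧ 3 ∤ c(D')` for every lattice-optimal `X₀(126)`-datum `D'` whose newform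
is the `χ`-twist (`χ` the primitive quadratic character mod `3`) of the newform of a lattice-optimal `X₀(42)`-datum on a curve good or
multiplicative at `3`.  No printed fact. [cite: CremonaAlgorithms1997, Table 1 (126)] -/
theorem shapes_on_family_fortyTwo_three [Fact (Nat.Prime 3)]
    (χ : DirichletCharacter ℂ 3) (hχ : χ.IsQuadratic) (hprim : χ.IsPrimitive)
    (W : WeierstrassCurve ℚ) [W.IsElliptic] [W.IsGloballyMinimal] (D : ModularParametrizationData W 42)
    (hopt : ∀ z ∈ D.L.lattice, ∃ w ∈ periodLattice D.f, z = D.c * w)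
    (hsemi : W.HasGoodReductionAtPrime 3 ∨ W.HasMultiplicativeReductionAtPrime 3)
    (W' : WeierstrassCurve ℚ) [W'.IsElliptic] [W'.IsGloballyMinimal] [NeZero (126 : ℕ)]
    (D' : ModularParametrizationData W' 126)
    (hf : ∀ n : ℕ, cuspCoeff D'.f n = χ n * cuspCoeff D.f n)
    (hopt' : ∀ z ∈ D'.L.lattice, ∃ w ∈ periodLattice D'.f, z = D'.c * w) :
    |D'.maninConstant| = 1 ∧ ¬ (3 : ℤ) ∣ D'.maninConstant :=
  have h1 := twistLevelManinOne_fortyTwo (p := 3) (by norm_num) χ hχ hprim W D hopt hsemi W' 126 D'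
    (by norm_num) (by norm_num) hf hopt'
  ⟨h1, not_dvd_of_abs_eq_one h1 (by decide)⟩

/-- **The residual C5 shape on `42a ⊗ χ₋₇` (level `294 = 2·3·7²`)**: `|c(D')| = 1 ∧ 7 ∤ c(D')` on the `7`-twist image of level `42` (the carrier
multiplicative at `7`).  No printed fact. [cite: CremonaAlgorithms1997, Table 1 (294)] -/
theorem shapes_on_family_fortyTwo_seven [Fact (Nat.Prime 7)]
    (χ : DirichletCharacter ℂ 7) (hχ : χ.IsQuadratic) (hprim : χ.IsPrimitive)
    (W : WeierstrassCurve ℚ) [W.IsElliptic] [W.IsGloballyMinimal] (D : ModularParametrizationData W 42)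
    (hopt : ∀ z ∈ D.L.lattice, ∃ w ∈ periodLattice D.f, z = D.c * w)
    (hsemi : W.HasGoodReductionAtPrime 7 ∨ W.HasMultiplicativeReductionAtPrime 7)
    (W' : WeierstrassCurve ℚ) [W'.IsElliptic] [W'.IsGloballyMinimal] [NeZero (294 : ℕ)]
    (D' : ModularParametrizationData W' 294)
    (hf : ∀ n : ℕ, cuspCoeff D'.f n = χ n * cuspCoeff D.f n)
    (hopt' : ∀ z ∈ D'.L.lattice, ∃ w ∈ periodLattice D'.f, z = D'.c * w) :
    |D'.maninConstant| = 1 ∧ ¬ (7 : ℤ) ∣ D'.maninConstant :=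
  have h1 := twistLevelManinOne_fortyTwo (p := 7) (by norm_num) χ hχ hprim W D hopt hsemi W' 294 D'
    (by norm_num) (by norm_num) hf hopt'
  ⟨h1, not_dvd_of_abs_eq_one h1 (by decide)⟩

end Summit.BirchSwinnertonDyer.BirchSwinnertonDyer.Theorems.ManinLocalTwoThree.TwistRootsFortyTwo

end
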